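import Mathlib
import HarnessLib
import Summits.HubbardSuperconductivity.HubbardSuperconductivity.Theorems.KLProgrammeKLRegimeEngineIsoSupportCountRegime
import Summits.HubbardSuperconductivity.HubbardSuperconductivity.Theorems.KLProgrammeKLRegimeEngineSpaceTimeBallCount

/-!
# Route `KLProgramme` — ENGINE item stmt-HubbardSuperconductivity-20437, class #6 / (E5-F)ₙ producer, route (M): M1 calibration, piece 3 —
# the NEAR COEFFICIENT `ε³·N_R³·(∏_{j<3} #supp F̄_{m,ω_{j+1}})/(βL²)³` of the M3 shape is SCALE-FREE in the KL regime: `≤ (C·(ρ + Λ_m)³)³` at near radius `R = ρ/Λ_m`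

Cell gate-hubbard-kl, seat hubbard-kl-k3c2-p2 (g11; owner-designate of M1 + M3 of route (M), pen (R59az)).  (R1) of the (α-0) memo in Lean, modulo the numeral: the near count
`N_R ≤ (2R/ε + 2)(2R + 2)²` (`card_spaceTimeBall_le_real`, p567688) contributes `ε·N_R ≤ (2R + 2)³ = 8(ρ + Λ_m)³/Λ_m³` per free leg at `R = ρ/Λ_m` (`ε ≤ 1`), the iso support count
`#supp/(βL²) ≤ C₀·Λ_m³` per leg (`card_support_klIsoFamily_div_le_of_thresholds`, …IsoSupportCountRegime), and the `Λ_m³` cancel: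

* **`near_coefficient_klIso_le_of_thresholds`** — `∃ C > 0` absolute such that in the regime (`L ≥ β²`, `β ≤ M`), for every `m ≤ n_β`, iso label tuple `Ω`, pin `x₁` and `ρ ≥ 0`:
  `ε³·N_{ρ/Λ_m}³·(∏_{j<3} #supp F̄_{m,ω_{j+1}})/(βL²)³ ≤ (C·(ρ + Λ_m)³)³` (`C = 8·C₀`).

So the near term of `fixedTupleL1_klIsoKernelAt_le_of_ballValue_moments_counts` reads `≤ (C(ρ+Λ_m)³)³·(B/24 + (Λ_m+π/β)·3·Mom)` and the far term `3·Mom·Λ_m/ρ`; the choice of `ρ` and the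
(E4-iso) moments `Mom` are M3 proper (T+).  Everything is proved; no definitions; nothing about the model is asserted; no numeral for `C` is claimed here
([paper] `C ≈ 8·10⁶`, see KL STATUS k3c2-p2 g11 ≈22:3xZ).  References: BGM 2006 §2.7 (2.69)–(2.71a) [cite: BenfattoGiulianiMastropietro2006].
-/

noncomputable section

namespace Summit.HubbardSuperconductivity.HubbardSuperconductivity.Theorems.EngineV8

set_option linter.dupNamespace false -- summit = problem name (single-conjunct summit), D-0017

open Set Finset Literature.MathematicalPhysics.QuantumLattice Literature.MathematicalPhysics.QuantumLattice.BandSectorCounting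
open Literature.MathematicalPhysics.QuantumLattice.FermiRG Literature.Probability.LatticeModels Literature.Analysis.SpecialFunctions
open Summit.HubbardSuperconductivity.HubbardSuperconductivity.Theorems.DispersionFlow
open Summit.HubbardSuperconductivity.HubbardSuperconductivity.Theorems.KLRegimeSplit
open Summit.HubbardSuperconductivity.HubbardSuperconductivity.Theorems.KLProgrammeLegKernels
open Summit.HubbardSuperconductivity.HubbardSuperconductivity.Theorems.PerturbedFermiCurve
open Summit.HubbardSuperconductivity.HubbardSuperconductivity.Theorems.TorusFourierL2
open scoped Real

section Regime

open Classical

/-- **THE NEAR COEFFICIENT OF THE M3 SHAPE IS SCALE-FREE IN THE KL REGIME**: one absolute `C` with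
`ε³·N_{ρ/Λ_m}³·(∏_{j<3} #supp F̄_{m,ω_{j+1}})/(βL²)³ ≤ (C·(ρ + Λ_m)³)³` for every admissible frame/window/coupling/temperature, `L ≥ β²`, `β ≤ M`, `m ≤ n_β`, `Ω`, `x₁`, `ρ ≥ 0`. -/
theorem near_coefficient_klIso_le_of_thresholds (ha : (-4 : ℝ) < -(6 / 5)) (hab : (-(6 / 5) : ℝ) ≤ -(1 / 10)) (hb : (-(1 / 10) : ℝ) < 0) :
    ∃ C : ℝ, 0 < C ∧ ∀ (R : RenConsts), (∀ j, 0 ≤ R.Gfr j) →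
      ∀ (c U : ℝ), 0 < c →
      c ≤ min (min ((bandBounds ha hab hb).Dtmin / 4) ((bandBounds ha hab hb).rhomin / 4)) (1 / 40) / (12 * (R.Gfr 2 + 1)) → 0 < U →
      U ≤ min 1 (min (min ((bandBounds ha hab hb).Dtmin / 4) ((bandBounds ha hab hb).rhomin / 4)) (1 / 40) / (24 * (R.Gfr 0 + R.Gfr 1 + 1))) →
      ∀ β : ℝ, klBetaMin ≤ β → β ≤ Real.exp (c / U ^ 2) → ∀ μ ∈ klWindowC, ∀ K : TrigPolyC4v, FrameOK R U (nScales β) μ K →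
      ∀ (L M : ℕ) [NeZero L] [NeZero M], β ^ 2 ≤ (L : ℝ) → β ≤ (M : ℝ) → ∀ m : ℕ, m ≤ nScales β →
      ∀ (Ω : Fin 4 → SectorLeg (sectorCount (2 * m))) (x₁ : SpaceTimeIdx L M) (ρ : ℝ), 0 ≤ ρ →
        imagTimeWeight β M ^ 3 *
              ((((univ : Finset (SpaceTimeIdx L M)).filter fun y => spaceTimeDist L M β x₁ y < ρ / klScale klE0 m).card : ℕ) : ℝ) ^ 3 *
            (∏ j : Fin 3, ((((univ : Finset (FreqMomentum L M)).filter fun q => klIsoFamily L M β μ K klE0 m (Ω j.succ).1.1 q ≠ 0).card : ℕ) : ℝ)) /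
          (β * (L : ℝ) ^ 2) ^ 3 ≤
        (C * (ρ + klScale klE0 m) ^ 3) ^ 3 := by
  obtain ⟨C₀, hC₀, hcount⟩ := card_support_klIsoFamily_div_le_of_thresholds ha hab hb
  refine ⟨8 * C₀, by positivity, ?_⟩
  intro R hR c U hc hcle hU hUle β hβmin hβc μ hμ K hK L M _ _ hLβ hβM m hmN Ω x₁ ρ hρ
  have hβ0 : 0 < β := pos_of_klBetaMin_le hβmin
  have hL0 : (0 : ℝ) < L := Nat.cast_pos.2 (NeZero.pos L)
  have hM0 : (0 : ℝ) < M := Nat.cast_pos.2 (NeZero.pos M)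
  set Λ : ℝ := klScale klE0 m with hΛdef
  have hΛ0 : 0 < Λ := klth_klScale_pos m
  set ε : ℝ := imagTimeWeight β M with hεdef
  have hε0 : 0 < ε := by rw [hεdef]; unfold imagTimeWeight; positivity
  have hε1 : ε ≤ 1 := by
    rw [hεdef, imagTimeWeight, div_le_one (by positivity)]; linarith
  set NR : ℝ := ((((univ : Finset (SpaceTimeIdx L M)).filter fun y => spaceTimeDist L M β x₁ y < ρ / Λ).card : ℕ) : ℝ) with hNR
  set S : Fin 3 → ℝ := fun j => ((((univ : Finset (FreqMomentum L M)).filter fun q =>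
    klIsoFamily L M β μ K klE0 m (Ω j.succ).1.1 q ≠ 0).card : ℕ) : ℝ) with hS
  have hS0 : ∀ j, 0 ≤ S j := fun j => Nat.cast_nonneg _
  have hNR0 : 0 ≤ NR := Nat.cast_nonneg _
  -- `ε·N_R ≤ (2R + 2ε)(2R + 2)² ≤ (2R + 2)³ = 8(ρ + Λ)³/Λ³`
  have hR0 : 0 ≤ ρ / Λ := div_nonneg hρ hΛ0.le
  have hεN : ε * NR ≤ 8 * (ρ + Λ) ^ 3 / Λ ^ 3 := by
    have h1 := eps_mul_nearCount_le hε0 (card_spaceTimeBall_le_real hβ0 x₁ hR0)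
    have h2 : (2 * (ρ / Λ) + 2 * ε) * (2 * (ρ / Λ) + 2) ^ 2 ≤ (2 * (ρ / Λ) + 2) ^ 3 := by
      have : 2 * (ρ / Λ) + 2 * ε ≤ 2 * (ρ / Λ) + 2 := by linarith
      calc (2 * (ρ / Λ) + 2 * ε) * (2 * (ρ / Λ) + 2) ^ 2 ≤ (2 * (ρ / Λ) + 2) * (2 * (ρ / Λ) + 2) ^ 2 :=
            mul_le_mul_of_nonneg_right this (by positivity)
        _ = (2 * (ρ / Λ) + 2) ^ 3 := by ring
    have e : (2 * (ρ / Λ) + 2) ^ 3 = 8 * (ρ + Λ) ^ 3 / Λ ^ 3 := by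
      field_simp
      ring
    exact h1.trans (h2.trans e.le)
  -- per leg: `ε·N_R·S_j/(βL²) ≤ 8(ρ+Λ)³/Λ³ · C₀ Λ³ = 8 C₀ (ρ+Λ)³`
  have hleg : ∀ j : Fin 3, ε * NR * S j / (β * (L : ℝ) ^ 2) ≤ 8 * C₀ * (ρ + Λ) ^ 3 := by
    intro j
    have hSj : S j / (β * (L : ℝ) ^ 2) ≤ C₀ * Λ ^ 3 := hcount R hR c U hc hcle hU hUle β hβmin hβc μ hμ K hK L M hLβ m hmN (Ω j.succ).1.1
    have hSj0 : 0 ≤ S j / (β * (L : ℝ) ^ 2) := div_nonneg (hS0 j) (by positivity)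
    calc ε * NR * S j / (β * (L : ℝ) ^ 2) = (ε * NR) * (S j / (β * (L : ℝ) ^ 2)) := by ring
      _ ≤ (8 * (ρ + Λ) ^ 3 / Λ ^ 3) * (C₀ * Λ ^ 3) := mul_le_mul hεN hSj hSj0 (by positivity)
      _ = 8 * C₀ * (ρ + Λ) ^ 3 := by field_simp
  have hleg0 : ∀ j : Fin 3, 0 ≤ ε * NR * S j / (β * (L : ℝ) ^ 2) := fun j => by
    have := hS0 j; positivity
  rw [near_coefficient_eq_prod ε NR β L S]
  calc ∏ j : Fin 3, ε * NR * S j / (β * (L : ℝ) ^ 2) ≤ ∏ _j : Fin 3, 8 * C₀ * (ρ + Λ) ^ 3 :=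
        prod_le_prod (fun j _ => hleg0 j) fun j _ => hleg j
    _ = (8 * C₀ * (ρ + Λ) ^ 3) ^ 3 := by rw [prod_const, card_univ, Fintype.card_fin]

end Regime

end Summit.HubbardSuperconductivity.HubbardSuperconductivity.Theorems.EngineV8

end
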